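import Summits.CriticalPhenomena.PercolationContinuityZ3.Theorems.PercNearOneGluingNoHeavyQuantTwoPointPairRouteZ3
import Summits.CriticalPhenomena.PercolationContinuityZ3.Theorems.PercNearOneGluingNoHeavyQuantTwoPointPairRouteBallPowerLaw
import Summits.CriticalPhenomena.PercolationContinuityZ3.Theorems.PercNearOneGluingNoHeavyQuantTwoPointPairRouteBallCrit
import HarnessLib

/-!
# QUANT lane / PAPER-2 rate track (ARM-2, gen 10): THE PAIR-ROUTE ROWS IN NUMERALS FOR `d = 4, 5, 6` (part 1: `κ_d`, bookkeeping, `d = 4`)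
# — the conditional power-law table of PAPER-2 for `3 ≤ d ≤ 6`, every constant a kernel numeral

builds on p205010 (kernel theorem, internal audit signed; external expert review pending)

Cell `prim-quant`, seat `prim-quant-arm-2` (constants bookkeeper), memo `RATE-CONSTANTS.md` §5.7.  Proof-only numerals file on top of
gen 9's generic pair-route theorems (`…QuantTwoPointPairRoutePowerLaw`: pointwise hypothesis, exponent `b′/(12d+4)`, constant
`195^c(2√C + K_d)`, `K_d = (20√2 d⁴(12d+4)5^{3d−1}κ_d)^{1/3}`; `…PairRouteBallPowerLaw`: ball hypothesis X_A, exponent `a′/(8d²+4d+6)`,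
`K′_d = (10√2 d³(2d)^{4d+2}(8d²+4d+6)7^{2d²}κ_d)^{1/(2d+2)}`; `…PairRouteBallCrit`: X_A with the `φ_{p_c} ≥ 1` input, exponent `a′/(8d²+8)`,
constant `195^c √(2C + K″_d)`, `K″_d = 5√2 d³(2d)^{6d+2}(4d²+4)7^{2d²}κ_d`), `κ_d = aknKappa d (1/(2d))` (Cerf's two-arms constant in the
window `[1/(2d), 1 − 1/(2d)] ∋ p_c(ℤ^d)`).  The `d = 3` rows are gen 9's `…PairRouteZ3` / `…PairRouteBallZ3` / `…PairRouteBallCritZ3`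
(`2^150 + 3√C`, `2^66 + 3√C`, `2^265 + 2√C`); this file and its part 2 `…PairRouteHigherDTable` supply `d = 4, 5, 6`:

* §1 `κ_4 ≤ 2^1109`, `κ_5 ≤ 2^2478`, `κ_6 ≤ 2^4858` as standalone numerals (gen 8's δ-generic pipeline `aknKappa_le_of_window`;
  true values `2^1106.5`, `2^2474.5`, `2^4851.1`);
* §2 root / final-constant bookkeeping lemmas (`B ≤ 2^{nk} ⇒ B^{1/n} ≤ 2^k`; `195^c(2√C + K) ≤ 2^{k+1} + 3√C`; `195^c√(2C + K) ≤ 2^{k+1} + 2√C`);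
* §3 THE TABLE (`d = 4` here, `d = 5, 6` in part 2; registry rows `OneArmPolyDecayAtCritical d c C′`; `b′ = min(b,1)`, `a′ = min(a,1)`):

  | d | pointwise `τ ≤ C‖x‖^{−b}`: c, C′ | X_A, bootstrap pair: c, C′ | X_A, φ-pair: c, C′ |
  |---|---|---|---|
  | 3 (gen 9) | b′/40, 2^150 + 3√C | a′/90, 2^66 + 3√C | a′/80, 2^265 + 2√C |
  | 4 | b′/52, 2^386 + 3√C | a′/150, 2^128 + 3√C | a′/136, 2^647 + 2√C |
  | 5 | b′/64, 2^845 + 3√C | a′/226, 2^227 + 3√C | a′/208, 2^1372 + 2√C |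
  | 6 | b′/76, 2^1641 + 3√C | a′/318, 2^371 + 3√C | a′/296, 2^2609 + 2√C |

  (`K_4 ≤ 2^385`: `20·(3/2)·256·52·5^{11} ≤ 2^45`, `45 + 1109 ≤ 3·385`; `K_5 ≤ 2^844`: `2^53`, `53 + 2478 ≤ 3·844`; `K_6 ≤ 2^1640`: `2^61`,
  `61 + 4858 ≤ 3·1640`; `K′_4 ≤ 2^127`: `2^161`, `161 + 1109 ≤ 10·127`; `K′_5 ≤ 2^226`: `2^233`, `12·226`; `K′_6 ≤ 2^370`: `2^316`, `14·370`;
  `√K″_4 ≤ 2^646`: `2^183`, `183 + 1109 ≤ 2·646`; `√K″_5 ≤ 2^1371`: `2^264`; `√K″_6 ≤ 2^2608`: `2^357`.)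
Second derivation of every numeral (exact rationals): `run/shared/lean/prim/quant/prim-quant-arm-2-g10/code/higher_d.py`.
HONEST FRAMING: implications from OPEN inputs (pointwise two-point decay / X_A at `p_c(ℤ^d)`, open in print for `3 ≤ d ≤ 6`, HvdH Open
Problem 10.1); the unconditional rate (class log*, `d = 3` display `1 − 2⁻¹⁹⁸⁶`) and the honest sentence are UNCHANGED.
[cite: Cerf2015, Prop. 5.2, Lemma 7.1 and §10] [cite: DuminilcopinKozmaTassion2020, §7 (38)–(40)] [cite: DuminilCopinTassionEM2016, Thm. 1.1]
[cite: HeydenreichVanDerHofstad2017, Open Problem 10.1]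
-/

noncomputable section

namespace Summit.CriticalPhenomena.PercolationContinuityZ3.Theorems.Quant

open MeasureTheory Literature.Probability.Percolation Literature.Probability.LatticeModels
open Summit.CriticalPhenomena.PercolationContinuityZ3.Theorems.SurfaceTension
open Literature.Probability.Percolation.AKN
open scoped Classical

/-! ## §1. Cerf's two-arms constant at the window `1/(2d)`, `d = 4, 5, 6` -/

set_option exponentiation.threshold 5000 in
/-- `κ_4 = aknKappa 4 (1/8) ≤ 2^1109` (`E = 754.9` nats: `13E ≤ 9·1091`; prefactor `≤ 2^18`; true `2^1106.5`). [cite: Cerf2015, Prop 5.2] -/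
theorem aknKappa_four_eighth_le : aknKappa 4 (1 / 8) ≤ (2 : ℝ) ^ 1109 :=
  aknKappa_le_of_window 4 (by norm_num) (e := 1091) (a₁ := 18) (a₂ := 13) (by norm_num) (by norm_num) (by norm_num)
    (by norm_num) (by norm_num) (by norm_num)

set_option exponentiation.threshold 5000 in
/-- `κ_5 = aknKappa 5 (1/10) ≤ 2^2478` (true `2^2474.5`). [cite: Cerf2015, Prop 5.2] -/
theorem aknKappa_five_tenth_le : aknKappa 5 (1 / 10) ≤ (2 : ℝ) ^ 2478 :=
  aknKappa_le_of_window 5 (by norm_num) (e := 2458) (a₁ := 20) (a₂ := 15) (by norm_num) (by norm_num) (by norm_num)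
    (by norm_num) (by norm_num) (by norm_num)

set_option exponentiation.threshold 5000 in
/-- `κ_6 = aknKappa 6 (1/12) ≤ 2^4858` (true `2^4851.1`). [cite: Cerf2015, Prop 5.2] -/
theorem aknKappa_six_twelfth_le : aknKappa 6 (1 / 12) ≤ (2 : ℝ) ^ 4858 :=
  aknKappa_le_of_window 6 (by norm_num) (e := 4835) (a₁ := 23) (a₂ := 18) (by norm_num) (by norm_num) (by norm_num)
    (by norm_num) (by norm_num) (by norm_num)

/-! ## §2. Bookkeeping lemmas -/

/-- `B ≤ 2^{n k}` (`B ≥ 0`, `n ≥ 1`) ⟹ `B^{1/n} ≤ 2^k`. [folklore] -/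
theorem rpow_one_div_le_two_pow {B : ℝ} {n k : ℕ} (hn : n ≠ 0) (hB0 : 0 ≤ B) (hB : B ≤ (2 : ℝ) ^ (n * k)) :
    B ^ (1 / (n : ℝ)) ≤ (2 : ℝ) ^ k := by
  have h1 : B ^ (1 / (n : ℝ)) ≤ ((2 : ℝ) ^ (n * k)) ^ (1 / (n : ℝ)) := Real.rpow_le_rpow hB0 hB (by positivity)
  have h2 : ((2 : ℝ) ^ (n * k)) ^ (1 / (n : ℝ)) = (2 : ℝ) ^ k := by
    rw [mul_comm, pow_mul, one_div, Real.pow_rpow_inv_natCast (by positivity) hn]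
  rw [h2] at h1; exact h1

/-- `P·√2·κ ≤ 2^{a + kb}` from `P·(3/2) ≤ 2^a` (`√2 ≤ 3/2`) and `κ ≤ 2^{kb}`. [folklore] -/
theorem prod_sqrt_two_kappa_le {P κ : ℝ} {a kb : ℕ} (hP0 : 0 ≤ P) (hP : P * (3 / 2) ≤ (2 : ℝ) ^ a)
    (hκ0 : 0 ≤ κ) (hκ : κ ≤ (2 : ℝ) ^ kb) : P * Real.sqrt 2 * κ ≤ (2 : ℝ) ^ (a + kb) := by
  have hs : Real.sqrt 2 ≤ 3 / 2 := (Real.sqrt_le_sqrt (by norm_num : (2 : ℝ) ≤ (3 / 2) ^ 2)).trans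
    (by rw [Real.sqrt_sq (by norm_num)])
  rw [pow_add]
  exact mul_le_mul ((mul_le_mul_of_nonneg_left hs hP0).trans hP) hκ hκ0 (by positivity)

/-- Final constant, additive form: `195^c ≤ 6/5`, `0 ≤ K ≤ 2^k` ⟹ `195^c (2√C + K) ≤ 2^{k+1} + 3√C`. [folklore] -/
theorem final_const_add_le {c C K : ℝ} {k : ℕ} (hc0 : 0 ≤ c) (hc : c ≤ 1 / 40) (hK0 : 0 ≤ K) (hK : K ≤ (2 : ℝ) ^ k) :
    (195 : ℝ) ^ c * (2 * Real.sqrt C + K) ≤ (2 : ℝ) ^ (k + 1) + 3 * Real.sqrt C := by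
  have h195 := rpow_195_le hc0 hc
  have hsC : 0 ≤ Real.sqrt C := Real.sqrt_nonneg C
  rw [pow_succ]
  calc (195 : ℝ) ^ c * (2 * Real.sqrt C + K) ≤ (6 / 5) * (2 * Real.sqrt C + (2 : ℝ) ^ k) :=
        mul_le_mul h195 (by linarith) (by positivity) (by norm_num)
    _ ≤ (2 : ℝ) ^ k * 2 + 3 * Real.sqrt C := by nlinarith only [hsC, pow_nonneg (show (0:ℝ) ≤ 2 by norm_num) k]

/-- Final constant, square-root form: `195^c ≤ 6/5`, `0 ≤ C`, `0 ≤ K ≤ 2^{2k}` ⟹ `195^c √(2C + K) ≤ 2^{k+1} + 2√C`. [folklore] -/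
theorem final_const_sqrt_le {c C K : ℝ} {k : ℕ} (hc0 : 0 ≤ c) (hc : c ≤ 1 / 40) (hC0 : 0 ≤ C) (hK0 : 0 ≤ K)
    (hK : K ≤ (2 : ℝ) ^ (2 * k)) :
    (195 : ℝ) ^ c * Real.sqrt (2 * C + K) ≤ (2 : ℝ) ^ (k + 1) + 2 * Real.sqrt C := by
  have h195 := rpow_195_le hc0 hc
  have hsC : 0 ≤ Real.sqrt C := Real.sqrt_nonneg C
  have h1 : Real.sqrt (2 * C + K) ≤ Real.sqrt (2 * C) + Real.sqrt K := by
    rw [Real.sqrt_le_left (by positivity)]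
    have h2 : Real.sqrt (2 * C) ^ 2 = 2 * C := Real.sq_sqrt (by positivity)
    have h3 : Real.sqrt K ^ 2 = K := Real.sq_sqrt hK0
    nlinarith [Real.sqrt_nonneg (2 * C), Real.sqrt_nonneg K]
  have h4 : Real.sqrt (2 * C) = Real.sqrt 2 * Real.sqrt C := Real.sqrt_mul (by norm_num) C
  have h5 : Real.sqrt K ≤ (2 : ℝ) ^ k := by
    rw [show ((2 : ℝ) ^ k) = Real.sqrt (((2 : ℝ) ^ k) ^ 2) by rw [Real.sqrt_sq (by positivity)]]
    refine Real.sqrt_le_sqrt (hK.trans ?_)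
    rw [← pow_mul, mul_comm]
  have h6 : Real.sqrt (2 * C + K) ≤ (3 / 2) * Real.sqrt C + (2 : ℝ) ^ k := by
    rw [h4] at h1
    have hs : Real.sqrt 2 ≤ 3 / 2 := (Real.sqrt_le_sqrt (by norm_num : (2 : ℝ) ≤ (3 / 2) ^ 2)).trans
      (by rw [Real.sqrt_sq (by norm_num)])
    exact h1.trans (add_le_add (mul_le_mul_of_nonneg_right hs hsC) h5)
  rw [pow_succ]
  calc (195 : ℝ) ^ c * Real.sqrt (2 * C + K) ≤ (6 / 5) * ((3 / 2) * Real.sqrt C + (2 : ℝ) ^ k) :=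
        mul_le_mul h195 h6 (Real.sqrt_nonneg _) (by norm_num)
    _ ≤ (2 : ℝ) ^ k * 2 + 2 * Real.sqrt C := by nlinarith only [hsC, pow_nonneg (show (0:ℝ) ≤ 2 by norm_num) k]

/-! ## §3a. `d = 4`: exponents `b′/52`, `a′/150`, `a′/136` -/

/-- `K_4 ≤ 2^385` (`20·(3/2)·4⁴·52·5^{11} ≤ 2^45`, `κ_4 ≤ 2^1109`, `45 + 1109 ≤ 1155`). [cite: Cerf2015, Prop. 5.2] -/
theorem pairConst_four_le :
    (20 * Real.sqrt 2 * (((4 : ℕ) : ℝ)) ^ 4 * (12 * (((4 : ℕ) : ℝ)) + 4) * 5 ^ (3 * 4 - 1) *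
        aknKappa 4 (1 / (2 * (((4 : ℕ) : ℝ))))) ^ (1 / 3 : ℝ) ≤ (2 : ℝ) ^ (385 : ℕ) := by
  have hδ : (1 / (2 * (((4 : ℕ) : ℝ))) : ℝ) = 1 / 8 := by norm_num
  rw [hδ]
  have hκ0 : 0 ≤ aknKappa 4 (1 / 8) := le_trans (by norm_num) (three_le_aknKappa 4 _)
  have h1 : 20 * Real.sqrt 2 * (((4 : ℕ) : ℝ)) ^ 4 * (12 * (((4 : ℕ) : ℝ)) + 4) * 5 ^ (3 * 4 - 1) * aknKappa 4 (1 / 8)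
      = (20 * 4 ^ 4 * 52 * 5 ^ 11) * Real.sqrt 2 * aknKappa 4 (1 / 8) := by
    rw [show 3 * 4 - 1 = 11 by norm_num]; push_cast; ring
  rw [h1, show (1 / 3 : ℝ) = 1 / ((3 : ℕ) : ℝ) by norm_num]
  refine rpow_one_div_le_two_pow (by norm_num) (mul_nonneg (by positivity) hκ0) ?_
  exact prod_sqrt_two_kappa_le (a := 45) (kb := 1109) (by norm_num) (by norm_num) hκ0 aknKappa_four_eighth_le |>.trans (pow_le_pow_right₀ (by norm_num) (by norm_num))

/-- **POINTWISE ⟹ (T1) ON `ℤ⁴`, PAIR ROUTE**: `τ_{p_c}(0,x) ≤ C‖x‖^{−b}` (`x ≠ 0`, `b > 0`) ⟹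
`OneArmPolyDecayAtCritical 4 (min(b,1)/52) (2^386 + 3√C)`.
builds on p205010 (kernel theorem, internal audit signed; external expert review pending).
[cite: Cerf2015, Prop. 5.2, Lemma 7.1 and §10] [cite: DuminilcopinKozmaTassion2020, §7 (38)–(39)] [cite: HeydenreichVanDerHofstad2017, Open Problem 10.1] -/
theorem oneArmPolyDecayAtCritical_Z4_of_pointwiseTwoPoint_pair {b C : ℝ} (hb0 : 0 < b)
    (hτ : ∀ x : Site 4, x ≠ 0 → tau 4 (criticalProbI 4) 0 x ≤ C * ‖x‖ ^ (-b)) :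
    OneArmPolyDecayAtCritical 4 (min b 1 / 52) ((2 : ℝ) ^ (386 : ℕ) + 3 * Real.sqrt C) := by
  have h := oneArmPolyDecayAtCritical_of_pointwiseTwoPoint_pair (d := 4) (by norm_num) hb0 hτ
  have hexp : min b 1 / (12 * (((4 : ℕ) : ℝ)) + 4) = min b 1 / 52 := by norm_num
  rw [hexp] at h
  refine oneArmPolyDecayAtCritical_const_mono h ?_
  have hc0 : 0 ≤ min b 1 / 52 := by have := lt_min hb0 one_pos; positivity
  have hc1 : min b 1 / 52 ≤ 1 / 40 := by have := min_le_right b 1; linarith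
  exact final_const_add_le hc0 hc1
    (Real.rpow_nonneg (mul_nonneg (by positivity) (le_trans (by norm_num) (three_le_aknKappa 4 _))) _) pairConst_four_le

/-- **THE PRINTED CONDITIONAL POWER LAW ON `ℤ⁴`, PAIR ROUTE**: IF `P_{p_c}(0 ↔ x) ≤ C‖x‖_∞^{−b}` for all `x ≠ 0` (`b > 0`), THEN
**`π_{p_c(ℤ⁴)}(n) ≤ (2^386 + 3√C) · n^{−min(b,1)/52}`** for every `n ≥ 1`.
builds on p205010 (kernel theorem, internal audit signed; external expert review pending).
[cite: Cerf2015, Prop. 5.2, Lemma 7.1 and §10] [cite: DuminilcopinKozmaTassion2020, §7 (38)–(39)] [cite: HeydenreichVanDerHofstad2017, Open Problem 10.1] -/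
theorem oneArm_powerLaw_Z4_of_pointwiseTwoPoint_pair {b C : ℝ} (hb0 : 0 < b)
    (hτ : ∀ x : Site 4, x ≠ 0 → (bondPercolation (zdGraph 4) (criticalProbI 4)).real (openConn 0 x) ≤ C * ‖x‖ ^ (-b)) :
    ∀ n : ℕ, 1 ≤ n → oneArmProb 4 (criticalProbI 4) n ≤ ((2 : ℝ) ^ (386 : ℕ) + 3 * Real.sqrt C) * (n : ℝ) ^ (-(min b 1 / 52)) :=
  fun n hn => oneArmPolyDecayAtCritical_Z4_of_pointwiseTwoPoint_pair hb0 hτ n hn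

/-- `K′_4 ≤ 2^127` (`10·(3/2)·64·8^{18}·150·7^{32} ≤ 2^161`, `161 + 1109 ≤ 10·127`). [cite: Cerf2015, Prop. 5.2] -/
theorem pairConstBall_four_le :
    (10 * Real.sqrt 2 * (((4 : ℕ) : ℝ)) ^ 3 * (2 * (((4 : ℕ) : ℝ))) ^ (4 * 4 + 2) * (8 * (((4 : ℕ) : ℝ)) ^ 2 + 4 * ((4 : ℕ) : ℝ) + 6) *
        7 ^ (2 * 4 ^ 2) * aknKappa 4 (1 / (2 * (((4 : ℕ) : ℝ))))) ^ (1 / (2 * (((4 : ℕ) : ℝ)) + 2)) ≤ (2 : ℝ) ^ (127 : ℕ) := by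
  have hδ : (1 / (2 * (((4 : ℕ) : ℝ))) : ℝ) = 1 / 8 := by norm_num
  have hex : (1 / (2 * (((4 : ℕ) : ℝ)) + 2) : ℝ) = 1 / ((10 : ℕ) : ℝ) := by norm_num
  rw [hδ, hex]
  have hκ0 : 0 ≤ aknKappa 4 (1 / 8) := le_trans (by norm_num) (three_le_aknKappa 4 _)
  have h1 : 10 * Real.sqrt 2 * (((4 : ℕ) : ℝ)) ^ 3 * (2 * (((4 : ℕ) : ℝ))) ^ (4 * 4 + 2) *
        (8 * (((4 : ℕ) : ℝ)) ^ 2 + 4 * ((4 : ℕ) : ℝ) + 6) * 7 ^ (2 * 4 ^ 2) * aknKappa 4 (1 / 8)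
      = (10 * 4 ^ 3 * 8 ^ 18 * 150 * 7 ^ 32) * Real.sqrt 2 * aknKappa 4 (1 / 8) := by
    rw [show 4 * 4 + 2 = 18 by norm_num, show 2 * 4 ^ 2 = 32 by norm_num]; push_cast; ring
  rw [h1]
  refine rpow_one_div_le_two_pow (by norm_num) (mul_nonneg (by positivity) hκ0) ?_
  exact prod_sqrt_two_kappa_le (a := 161) (kb := 1109) (by norm_num) (by norm_num) hκ0 aknKappa_four_eighth_le |>.trans (pow_le_pow_right₀ (by norm_num) (by norm_num))

/-- **X_A ⟹ (T1) ON `ℤ⁴`, PAIR ROUTE (bootstrap)**: `Σ_{x ∈ Λ_R} τ_{p_c}(0,x) ≤ C R^{4−a}` for all `R ≥ 1` (`a > 0`) ⟹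
`OneArmPolyDecayAtCritical 4 (min(a,1)/150) (2^128 + 3√C)`.
builds on p205010 (kernel theorem, internal audit signed; external expert review pending).
[cite: Cerf2015, Lemma 7.1 and §10] [cite: DuminilcopinKozmaTassion2020, §7 (38)–(40)] [cite: HeydenreichVanDerHofstad2017, Open Problem 10.1] -/
theorem oneArmPolyDecayAtCritical_Z4_of_ballTwoPoint_pair {a C : ℝ} (ha0 : 0 < a)
    (hS : ∀ R : ℕ, 1 ≤ R → ∑ x ∈ box 4 R, tau 4 (criticalProbI 4) 0 x ≤ C * (R : ℝ) ^ ((4 : ℝ) - a)) :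
    OneArmPolyDecayAtCritical 4 (min a 1 / 150) ((2 : ℝ) ^ (128 : ℕ) + 3 * Real.sqrt C) := by
  have hS' : ∀ R : ℕ, 1 ≤ R → ∑ x ∈ box 4 R, tau 4 (criticalProbI 4) 0 x ≤ C * (R : ℝ) ^ ((((4 : ℕ) : ℝ)) - a) := by
    intro R hR; rw [show (((4 : ℕ) : ℝ)) = (4 : ℝ) by norm_num]; exact hS R hR
  have h := oneArmPolyDecayAtCritical_of_ballTwoPoint_pair (d := 4) (by norm_num) ha0 hS'
  have hexp : min a 1 / (8 * (((4 : ℕ) : ℝ)) ^ 2 + 4 * ((4 : ℕ) : ℝ) + 6) = min a 1 / 150 := by norm_num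
  rw [hexp] at h
  refine oneArmPolyDecayAtCritical_const_mono h ?_
  have hc0 : 0 ≤ min a 1 / 150 := by have := lt_min ha0 one_pos; positivity
  have hc1 : min a 1 / 150 ≤ 1 / 40 := by have := min_le_right a 1; linarith
  exact final_const_add_le hc0 hc1
    (Real.rpow_nonneg (mul_nonneg (by positivity) (le_trans (by norm_num) (three_le_aknKappa 4 _))) _) pairConstBall_four_le

/-- `K″_4 ≤ 2^{1292}` (`5·(3/2)·64·8^{26}·68·7^{32} ≤ 2^183`, `183 + 1109 = 1292`). [cite: Cerf2015, Prop. 5.2] -/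
theorem pairConstCrit_four_le :
    5 * Real.sqrt 2 * (((4 : ℕ) : ℝ)) ^ 3 * (2 * (((4 : ℕ) : ℝ))) ^ (6 * 4 + 2) * (4 * (((4 : ℕ) : ℝ)) ^ 2 + 4) * 7 ^ (2 * 4 ^ 2) *
        aknKappa 4 (1 / (2 * (((4 : ℕ) : ℝ)))) ≤ (2 : ℝ) ^ (2 * 646) := by
  have hδ : (1 / (2 * (((4 : ℕ) : ℝ))) : ℝ) = 1 / 8 := by norm_num
  rw [hδ]
  have hκ0 : 0 ≤ aknKappa 4 (1 / 8) := le_trans (by norm_num) (three_le_aknKappa 4 _)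
  have h1 : 5 * Real.sqrt 2 * (((4 : ℕ) : ℝ)) ^ 3 * (2 * (((4 : ℕ) : ℝ))) ^ (6 * 4 + 2) * (4 * (((4 : ℕ) : ℝ)) ^ 2 + 4) * 7 ^ (2 * 4 ^ 2) *
        aknKappa 4 (1 / 8) = (5 * 4 ^ 3 * 8 ^ 26 * 68 * 7 ^ 32) * Real.sqrt 2 * aknKappa 4 (1 / 8) := by
    rw [show 6 * 4 + 2 = 26 by norm_num, show 2 * 4 ^ 2 = 32 by norm_num]; push_cast; ring
  rw [h1]
  exact prod_sqrt_two_kappa_le (a := 183) (kb := 1109) (by norm_num) (by norm_num) hκ0 aknKappa_four_eighth_le |>.trans (pow_le_pow_right₀ (by norm_num) (by norm_num))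

/-- **X_A ⟹ (T1) ON `ℤ⁴`, `φ`-PAIR ROUTE**: `Σ_{x ∈ Λ_R} τ_{p_c}(0,x) ≤ C R^{4−a}` for all `R ≥ 1` (`a > 0`) ⟹
`OneArmPolyDecayAtCritical 4 (min(a,1)/136) (2^647 + 2√C)` — the best conditional exponent for X_A on `ℤ⁴` in the tree.
builds on p205010 (kernel theorem, internal audit signed; external expert review pending).
[cite: Cerf2015, Lemma 6.1, Lemma 7.1 and §10] [cite: DuminilCopinTassionEM2016, Thm. 1.1] [cite: HeydenreichVanDerHofstad2017, Open Problem 10.1] -/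
theorem oneArmPolyDecayAtCritical_Z4_of_ballTwoPoint_pair_crit {a C : ℝ} (ha0 : 0 < a)
    (hS : ∀ R : ℕ, 1 ≤ R → ∑ x ∈ box 4 R, tau 4 (criticalProbI 4) 0 x ≤ C * (R : ℝ) ^ ((4 : ℝ) - a)) :
    OneArmPolyDecayAtCritical 4 (min a 1 / 136) ((2 : ℝ) ^ (647 : ℕ) + 2 * Real.sqrt C) := by
  have hS' : ∀ R : ℕ, 1 ≤ R → ∑ x ∈ box 4 R, tau 4 (criticalProbI 4) 0 x ≤ C * (R : ℝ) ^ ((((4 : ℕ) : ℝ)) - a) := by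
    intro R hR; rw [show (((4 : ℕ) : ℝ)) = (4 : ℝ) by norm_num]; exact hS R hR
  have hC1 : 1 ≤ C := one_le_const_of_ballTwoPoint (criticalProbI 4) hS'
  have h := oneArmPolyDecayAtCritical_of_ballTwoPoint_pair_crit (d := 4) (by norm_num) ha0 hS'
  have hexp : min a 1 / (8 * (((4 : ℕ) : ℝ)) ^ 2 + 8) = min a 1 / 136 := by norm_num
  rw [hexp] at h
  refine oneArmPolyDecayAtCritical_const_mono h ?_
  have hc0 : 0 ≤ min a 1 / 136 := by have := lt_min ha0 one_pos; positivity
  have hc1 : min a 1 / 136 ≤ 1 / 40 := by have := min_le_right a 1; linarith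
  exact final_const_sqrt_le hc0 hc1 (by linarith)
    (mul_nonneg (by positivity) (le_trans (by norm_num) (three_le_aknKappa 4 _))) pairConstCrit_four_le

end Summit.CriticalPhenomena.PercolationContinuityZ3.Theorems.Quant

end
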